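import Literature.NumberTheory.LFunctions.LagariasRains2003.Certificate
import HarnessLib

/-!
# Lagarias–Rains (2003), §7.3 Question 1 — the kernel certificate at the corner point `(−16, −1/20 + i)`

J. C. Lagarias and E. Rains, *On a two-variable zeta function for number fields*,
Ann. Inst. Fourier **53** (2003) 1–68 [LagariasRains2003], §7.3 Question 1 asks whether
`Re Z_ℚ(w, s) > 0` on the whole cone `C⁻ = {w = u real, u < Re s < 0}`. Besides the point
`(−16, −1/100 + i)` of `LagariasRains2003.Refutation`, the answer is also negative at the corner point
`(w, s) = (−16, −1/20 + i)` (`LagariasRains2003.Corner`), where by Theorem 2.1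
`Re Z_ℚ = 20/401 + 6380/102161 − ∫_1^∞ h_c(t) dt`,
`h_c(t) = (1 − θ(t²)^{−16})(t^{−21/20} + t^{−339/20}) cos(log t) ≥ 0`.

This file is the integer program for that point, identical in shape to `LagariasRains2003.Certificate`
(same scale `PREC = 2^64`, same nodes `t = n/64`, `65 ≤ n ≤ 128`, same interval primitives of
`Literature.Analysis.ValidatedNumerics`) with the exponents `−21/20`, `−339/20` and the bound
`Σ_n ⌊⌊ab/PREC⌋c/PREC⌋ ≥ 64·PREC·(20/401 + 6380/102161 + 1/1000)` (`certCorner`, evaluated in the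
kernel by `certCorner_true`; standard axioms, no `native_decide`). Soundness is proved in
`LagariasRains2003.Corner`.
-/

open Literature.Analysis.ValidatedNumerics Literature.Analysis.ValidatedNumerics.NumericsMP

namespace Literature.NumberTheory.LFunctions.LagariasRains2003

/-- For the node `t = n/64`: scaled lower bounds `(a, b, c)`, all `≥ 0`, of
`1 − (1 + 2e^{−π t²})^{−16}`, `t^{−21/20} + t^{−339/20}` and `cos (log t)`, given an
enclosure `P ∋ π`. [folklore] -/
def nodePartsC (P : MI) (n : ℕ) : Option (ℤ × ℤ × ℤ) :=
  match MI.exp PREC KSER KHALF (MI.neg (MI.mul PREC P (MI.ofFrac PREC ((n * n : ℕ) : ℤ) 4096))),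
    logRatio n with
  | some E, some L =>
    let q : ℤ := max E.lo 0
    let P16 : ℤ := (MI.sqrIter PREC 4 (MI.ofScaled ((PREC : ℤ) + 2 * q))).lo
    if 0 < P16 then
      match MI.exp PREC KSER KHALF ((L.mulInt (-21)).divNat 20),
        MI.exp PREC KSER KHALF ((L.mulInt (-339)).divNat 20),
        MC.expI PREC KSER KHALF P L with
      | some E1, some E2, some C =>
        some (max ((PREC : ℤ) - Numerics.cdiv ((PREC : ℤ) * PREC) P16) 0,
          max (E1.lo + E2.lo) 0, max C.re.lo 0)
      | _, _, _ => none
    else none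
  | _, _ => none

/-- Scaled lower bound `⌊⌊ab/PREC⌋·c/PREC⌋` for `h_c(n/64)`. [folklore] -/
def nodeLoC (P : MI) (n : ℕ) : Option ℤ :=
  match nodePartsC P n with
  | some (a, b, c) => some (a * b / (PREC : ℤ) * c / (PREC : ℤ))
  | none => none

/-- Scaled lower bound for `Σ_{i<N} h_c((65+i)/64)`. [folklore] -/
def sumLoC (P : MI) : ℕ → Option ℤ
  | 0 => some 0
  | i + 1 =>
    match sumLoC P i, nodeLoC P (65 + i) with
    | some a, some b => some (a + b)
    | _, _ => none

/-- **The certificate at the corner point**: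
`(1/64) Σ_{n=65}^{128} h_c(n/64) ≥ 20/401 + 6380/102161 + 1/1000`, as the integer inequality
`T·401·102161·1000 ≥ 64·PREC·(20·102161·1000 + 6380·401·1000 + 401·102161)`.
[cite: LagariasRains2003, §7.3 Question 1] -/
def certCorner : Bool :=
  match MI.pi PREC KSER with
  | some P =>
    match sumLoC P 64 with
    | some T => decide (64 * (PREC : ℤ) * (20 * 102161 * 1000 + 6380 * 401 * 1000 +
        401 * 102161) ≤ T * (401 * 102161 * 1000))
    | none => false
  | none => false

set_option maxHeartbeats 4000000 in
/-- The corner-point certificate evaluates to `true` in the kernel (GMP-accelerated `Nat`/`Int`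
reduction; standard axioms, no `native_decide`). [cite: LagariasRains2003, §7.3 Question 1] -/
theorem certCorner_true : certCorner = true := by decide +kernel

end Literature.NumberTheory.LFunctions.LagariasRains2003
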